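import Summits.MatrixMultiplication.MatrixMultiplication.Theses.LevelGradedCohnUmans
import Summits.MatrixMultiplication.MatrixMultiplication.Theorems.LevelTwoBeatsCubes.Negative.GradedNeumannCount
import Summits.MatrixMultiplication.MatrixMultiplication.Theorems.LevelTwoBeatsCubes.Negative.TwoTokenSpace

/-!
# Refutation of `LevelGradedCohnUmans.LevelTwoBeatsCubes` (stmt-MatrixMultiplication-7612)

The crux asked for `n` and `X, Y, Z ⊆ 𝔖ₙ`, 2-token separated (for every target `(x₀, z₀)` a
function `f(g) = Σ_{p : [2] → [n]} c_p (g ∘ p)` with `f(x⁻¹ y y'⁻¹ z) = [x = x₀ ∧ y = y' ∧ z = z₀]`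
on `X × Y × Y × Z`), of volume `|X||Y||Z| > B₃(n) := 1 + (n-1)³ + (n(n-3)/2)³ + ((n-1)(n-2)/2)³`.
It is FALSE for every `n` (graded Neumann packing count; idea card `graded-neumann-rank`):

* `Negative/GradedNeumannCount.lean`: `|X||Z| + |X|(|Y|-1) ≤ dim J` and `|X||Z| + (|Y|-1)|Z| ≤ dim J`
  for triples separated by a right/left-invariant `J ≤ ℂ^G` (targets `X⁻¹Z` + one translated slab),
  and the cubic budget `|X||Y||Z| ≤ pD + p² - p³ ≤ B` (`p = min(|X|,|Z|)`) under
  `4D + 1 ≤ 8B ∧ 4(4D+1)³ ≤ 27(8B-4D-1)²`;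
* `Negative/TwoTokenSpace.lean`: the separators lie in the bi-invariant 2-token space `J₂`, and
  `dim J₂ ≤ n!`, `dim J₂(𝔖_{m+1}) ≤ 1 + (m² + C(m,2)(m²-m))`;
* here: the budget bookkeeping (`n ≤ 2`: `D = B ≤ 2`; `n = 3, 4`: `D = 6, 24`; `n = k+5`: the
  spanning-family bound, where `27(8B-4D-1)² - 4(4D+1)³` and `8B - 4D - 1` are polynomials in `k`
  with non-negative integer coefficients) and the assembly.

Numerically: `n = 3: V ≤ 8 < 10`, `n = 4: V ≤ 54 < 63`, `n = 5: V ≤ 325 < 406`, and asymptotically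
`V ≤ 0.385·D^{3/2}` against `B₃ ≈ 0.707·D₂^{3/2}`; the level-2 window of the route is empty for all `n`.
-/

namespace Summit.MatrixMultiplication.MatrixMultiplication.Theses.LevelGradedCohnUmans

open scoped BigOperators Topology Manifold Classical MeasureTheory ProbabilityTheory Matrix InnerProductSpace ComplexConjugate ContinuousMap
open Filter Set Function TopologicalSpace MeasureTheory

/-- **Record of the replaced/dropped route item `LevelTwoBeatsCubes`** = stmt-MatrixMultiplication-7612 (ledger signature verbatim, in
the route file's namespace and `open` context; NOT a route item): after `LevelGradedCohnUmansLevelTwoBeatsCubes_refuted` (below) closed the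
item `refuted` at 82fdab13498c, the route repair (`restate` under a new name, or `drop`) removed
this constant from the gate-written Theses file, while the Theorems file below — append-only,
statement text fixed — still names it ("Unknown identifier" in the full builds of 2026-08-16).
Re-declared here under its original fully-qualified name and definiens solely so that this record
keeps elaborating. FALSE (refuted below). -/
def LevelTwoBeatsCubes : Prop :=
  ∃ (n : ℕ) (X Y Z : Finset (Equiv.Perm (Fin n))), (∀ x₀ ∈ X, ∀ z₀ ∈ Z, ∃ c : (Fin 2 → Fin n) → (Fin 2 → Fin n) → ℂ, ∀ x ∈ X, ∀ y ∈ Y, ∀ y' ∈ Y, ∀ z ∈ Z, (∑ p : Fin 2 → Fin n, c p (⇑(x⁻¹ * y * y'⁻¹ * z) ∘ p)) = if x = x₀ ∧ y = y' ∧ z = z₀ then 1 else 0) ∧ 1 + (n - 1) ^ 3 + (n * (n - 3) / 2) ^ 3 + ((n - 1) * (n - 2) / 2) ^ 3 < X.card * Y.card * Z.card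

end Summit.MatrixMultiplication.MatrixMultiplication.Theses.LevelGradedCohnUmans

namespace Summit.MatrixMultiplication.MatrixMultiplication.Theorems

open Module LevelTwoBeatsCubes.Negative

/-- Budget bookkeeping for `n = k + 5`: with `D = 1 + (m² + C(m,2)(m² - m))` (`m = k + 4`) and
`B = 1 + (n-1)³ + (n(n-3)/2)³ + ((n-1)(n-2)/2)³`, the two numeric conditions of the cubic budget
hold (polynomial identities with non-negative coefficients in `k`). -/
private theorem budget_conditions (k D B : ℕ)
    (hD : D = 1 + ((k + 4) * (k + 4) + (k + 4).choose 2 * ((k + 4) * (k + 4) - (k + 4))))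
    (hB : B = 1 + (k + 5 - 1) ^ 3 + ((k + 5) * (k + 5 - 3) / 2) ^ 3
      + ((k + 5 - 1) * (k + 5 - 2) / 2) ^ 3) :
    ((4 * D + 1 : ℝ) ≤ 8 * B) ∧
      (4 * (4 * (D : ℝ) + 1) ^ 3 ≤ 27 * (8 * (B : ℝ) - 4 * D - 1) ^ 2) := by
  -- q := C(k+4, 2) with 2 q = (k+4)(k+3)
  have hq2 : (k + 4).choose 2 * 2 = (k + 4) * (k + 3) := by
    have h := Nat.choose_two_right (k + 4)
    have hdvd : 2 ∣ (k + 4) * (k + 4 - 1) := by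
      have h2 := (Nat.even_mul_succ_self (k + 3)).two_dvd
      have e : (k + 4) * (k + 4 - 1) = (k + 3) * (k + 3 + 1) := by
        rw [show k + 4 - 1 = k + 3 from rfl]
        ring
      rw [e]
      exact h2
    rw [h, Nat.div_mul_cancel hdvd]
    rw [show k + 4 - 1 = k + 3 from rfl]
  have hmm : (k + 4) * (k + 4) - (k + 4) = (k + 4) * (k + 3) := by
    have : (k + 4) * (k + 4) = (k + 4) * (k + 3) + (k + 4) := by ring
    exact Nat.sub_eq_of_eq_add this
  have e1 : k + 5 - 1 = k + 4 := rfl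
  have e2 : k + 5 - 3 = k + 2 := rfl
  have e3 : k + 5 - 2 = k + 3 := rfl
  have hB1 : (k + 5 - 1) * (k + 5 - 2) / 2 = (k + 4).choose 2 := by
    rw [e1, e3]
    apply Nat.div_eq_of_eq_mul_left (by norm_num)
    rw [hq2]
  have hqpos : 1 ≤ (k + 4).choose 2 := by
    have : 12 ≤ (k + 4).choose 2 * 2 := by rw [hq2]; nlinarith
    omega
  have hB2 : (k + 5) * (k + 5 - 3) / 2 = (k + 4).choose 2 - 1 := by
    rw [e2]
    apply Nat.div_eq_of_eq_mul_left (by norm_num)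
    have h3 : ((k + 4).choose 2 - 1) * 2 = (k + 4).choose 2 * 2 - 2 := by omega
    rw [h3, hq2]
    have h4 : (k + 4) * (k + 3) = (k + 5) * (k + 2) + 2 := by ring
    rw [h4, Nat.add_sub_cancel]
  set q := (k + 4).choose 2 with hq
  have hD' : (D : ℝ) = 1 + (k + 4) * (k + 4) + q * ((k + 4) * (k + 3)) := by
    rw [hD, hmm]
    push_cast
    ring
  have hB' : (B : ℝ) = 1 + (k + 4) ^ 3 + (q - 1) ^ 3 + q ^ 3 := by
    rw [hB, hB2, hB1, e1]
    push_cast [Nat.cast_sub hqpos]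
    ring
  have hqR : (q : ℝ) = (k + 4) * (k + 3) / 2 := by
    have h5 : ((q * 2 : ℕ) : ℝ) = (((k + 4) * (k + 3) : ℕ) : ℝ) := by rw [hq2]
    push_cast at h5
    linarith
  rw [hD', hB', hqR]
  constructor
  · have key : 8 * (1 + ((k : ℝ) + 4) ^ 3 + ((k + 4) * (k + 3) / 2 - 1) ^ 3
          + ((k + 4) * (k + 3) / 2) ^ 3)
        - (4 * (1 + ((k : ℝ) + 4) * (k + 4) + (k + 4) * (k + 3) / 2 * ((k + 4) * (k + 3))) + 1)
        = 2891 + 5140 * k + 3912 * k ^ 2 + 1590 * k ^ 3 + 358 * k ^ 4 + 42 * k ^ 5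
          + 2 * k ^ 6 := by
      ring
    have hpos : (0 : ℝ) ≤ 2891 + 5140 * k + 3912 * k ^ 2 + 1590 * k ^ 3 + 358 * k ^ 4
          + 42 * k ^ 5 + 2 * k ^ 6 := by
      positivity
    linarith [key, hpos]
  · have key : 27 * (8 * (1 + ((k : ℝ) + 4) ^ 3 + ((k + 4) * (k + 3) / 2 - 1) ^ 3
          + ((k + 4) * (k + 3) / 2) ^ 3)
          - 4 * (1 + ((k : ℝ) + 4) * (k + 4) + (k + 4) * (k + 3) / 2 * ((k + 4) * (k + 3))) - 1) ^ 2
        - 4 * (4 * (1 + ((k : ℝ) + 4) * (k + 4) + (k + 4) * (k + 3) / 2 * ((k + 4) * (k + 3))) + 1) ^ 3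
        = 43665615 + 239611176 * k + 514482552 * k ^ 2 + 618915388 * k ^ 3 + 478913652 * k ^ 4
          + 254653476 * k ^ 5 + 96081600 * k ^ 6 + 26013864 * k ^ 7 + 5026116 * k ^ 8
          + 676592 * k ^ 9 + 60276 * k ^ 10 + 3192 * k ^ 11 + 76 * k ^ 12 := by
      ring
    have hpos : (0 : ℝ) ≤ 43665615 + 239611176 * k + 514482552 * k ^ 2 + 618915388 * k ^ 3
          + 478913652 * k ^ 4 + 254653476 * k ^ 5 + 96081600 * k ^ 6 + 26013864 * k ^ 7
          + 5026116 * k ^ 8 + 676592 * k ^ 9 + 60276 * k ^ 10 + 3192 * k ^ 11 + 76 * k ^ 12 := by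
      positivity
    linarith [key, hpos]

/-- Refutes `LevelGradedCohnUmans.LevelTwoBeatsCubes` [refuted-substantive]: there is NO `n` and no
2-token-separated triple `X, Y, Z ⊆ 𝔖ₙ` with `|X||Y||Z| > 1 + (n-1)³ + (n(n-3)/2)³ + ((n-1)(n-2)/2)³`.
Witness of falsity (a theorem, for every `n`): the graded Neumann count
`|X||Z| + max(|X|,|Z|)(|Y|-1) ≤ dim J₂ ≤ min(n!, 1+(n-1)²+C(n-1,2)((n-1)²-(n-1)))` and the cubic
budget `V ≤ pD + p² - p³ ≤ B₃(n)` (`p = min(|X|,|Z|)`). No cheap repair: the level-2 window is empty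
for all `n` (any volume threshold above `0.385·D₂^{3/2}(1+o(1))`, in particular
`B₃ ≈ 0.707·D₂^{3/2}`, is out of reach of 2-token-separated triples); weakening "2-token" to
"k-token" is the separate crux `SnLevelDesigns` (levels `k ≤ 6` die the same way asymptotically).
barrier-candidate: the graded packing bound `J`-separated ⇒ `|X||Z| + max(|X|,|Z|)(|Y|-1) ≤ dim J`
for every bi-invariant `J ≤ ℂ^G` (`Negative/GradedNeumannCount.lean`). -/
theorem LevelGradedCohnUmansLevelTwoBeatsCubes_refuted :
    ¬ Summit.MatrixMultiplication.MatrixMultiplication.Theses.LevelGradedCohnUmans.LevelTwoBeatsCubes := by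
  rintro ⟨n, X, Y, Z, hsep, hlt⟩
  classical
  -- the budget
  set B := 1 + (n - 1) ^ 3 + (n * (n - 3) / 2) ^ 3 + ((n - 1) * (n - 2) / 2) ^ 3 with hBdef
  clear_value B
  -- nonemptiness
  have hXne : X.card ≠ 0 := by intro h; rw [h] at hlt; simp at hlt
  have hYne : Y.card ≠ 0 := by intro h; rw [h] at hlt; simp at hlt
  have hZne : Z.card ≠ 0 := by intro h; rw [h] at hlt; simp at hlt
  obtain ⟨x₁, hx₁⟩ := Finset.card_ne_zero.1 hXne
  obtain ⟨y₁, hy₁⟩ := Finset.card_ne_zero.1 hYne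
  obtain ⟨z₁, hz₁⟩ := Finset.card_ne_zero.1 hZne
  -- separators lie in J₂
  have hsepJ : ∀ x₀ ∈ X, ∀ z₀ ∈ Z, ∃ f ∈ J2 n, ∀ x ∈ X, ∀ y ∈ Y, ∀ y' ∈ Y, ∀ z ∈ Z,
      (x = x₀ ∧ y = y' ∧ z = z₀ → f (x⁻¹ * y * y'⁻¹ * z) = 1) ∧
      (¬ (x = x₀ ∧ y = y' ∧ z = z₀) → f (x⁻¹ * y * y'⁻¹ * z) = 0) := by
    intro x₀ hx₀ z₀ hz₀
    obtain ⟨c, hc⟩ := hsep x₀ hx₀ z₀ hz₀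
    refine ⟨fun g => ∑ p, c p (⇑g ∘ p), tok_mem c, ?_⟩
    intro x hx y hy y' hy' z hz
    have h := hc x hx y hy y' hy' z hz
    constructor
    · intro H
      show (∑ p, c p (⇑(x⁻¹ * y * y'⁻¹ * z) ∘ p)) = 1
      rw [h, if_pos H]
    · intro H
      show (∑ p, c p (⇑(x⁻¹ * y * y'⁻¹ * z) ∘ p)) = 0
      rw [h, if_neg H]
  -- the two packing inequalities
  have N1 := packing_X (J2 n) (fun f hf h => comp_right_mem f hf h) X Y Z hsepJ hy₁ hz₁
  have N2 := packing_Z (J2 n) (fun f hf h => comp_left_mem f hf h) X Y Z hsepJ hx₁ hy₁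
  have hb : 1 ≤ Y.card := Nat.pos_of_ne_zero hYne
  -- a dimension bound D with the cubic budget closes the argument
  have main : ∀ D : ℕ, finrank ℂ (J2 n) ≤ D → (∀ p : ℕ, p * D + p ^ 2 ≤ p ^ 3 + B) → False := by
    intro D hD hh
    have hV := vol_le X.card Y.card Z.card D B hb (N1.trans hD) (N2.trans hD) hh
    exact absurd hlt (not_lt.2 hV)
  rcases Nat.lt_or_ge n 5 with hn | hn
  · interval_cases n
    · exact main 1 (finrank_J2_le_factorial.trans (by decide))
        (cubic_le_small 1 B (by norm_num [hBdef]) (by norm_num))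
    · exact main 1 (finrank_J2_le_factorial.trans (by decide))
        (cubic_le_small 1 B (by norm_num [hBdef]) (by norm_num))
    · exact main 2 (finrank_J2_le_factorial.trans (by decide))
        (cubic_le_small 2 B (by norm_num [hBdef]) (by norm_num))
    · exact main 6 (finrank_J2_le_factorial.trans (by decide))
        (cubic_le_nat 6 B (by norm_num [hBdef]) (by norm_num [hBdef]))
    · exact main 24 (finrank_J2_le_factorial.trans (by decide))
        (cubic_le_nat 24 B (by norm_num [hBdef]) (by norm_num [hBdef]))
  · obtain ⟨k, rfl⟩ := Nat.exists_eq_add_of_le' hn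
    have hc := budget_conditions k _ B rfl hBdef
    exact main _ (finrank_J2_succ_le (m := k + 4)) (cubic_le_nat _ B hc.1 hc.2)

end Summit.MatrixMultiplication.MatrixMultiplication.Theorems
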